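import Summits.CriticalPhenomena.PercolationContinuityZ3.Theorems.PercNearOneGluingNoHeavyLowerTailSunflowerTypeModelPsi
import HarnessLib

/-!
# `NoHeavyLowerTail` (crux stmt-CriticalPhenomena-4575), abstract sunflower cubic: TYPE MODEL, part 4 — DECODING (`Ψ` is injective
# for a fixed plan) and NO COLLISIONS ACROSS PATH LENGTHS (memo §4.4–§4.5)

Support file (seat `prim-ineq-prove-1` gen 40; `--supports stmt-CriticalPhenomena-4575`).  No `sorry`, no named facts.  Memo:
run/shared/lean/prim/prim-ineq-prove-1/FINDING-BIPARTITE-prove1-g40.md (§3 the type model, §4 the injection Ψ).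

THE PROGRAMME.  THEOREM (memo): every BIPARTITE graph core `edgeCore Γ` is A-safe (Lemma A for every number of petals and every
product measure).  Polarisation + symmetrisation + conditioning on one side of the bipartition reduce it to the purely finite
TYPE-MODEL LEMMA `TypeModel.Model.typeModel_lemma` (file `…SunflowerTypeModelLemma`): for K slots, elements with killer types
`τ x ⊆ [K]` and multiplicities, petal labels and an orientation digraph `O`, one has, for every multiplicity profile,
`Σ_{BAD S} (K − |nonA S|)! ≤ (K−1)!·#GOOD`.  The proof is an explicit injection `(S, enumeration) ↦ (Ψ S, key)`: rotate the contents
of the non-A slots along a Hamiltonian path of `O|_N` whose start dominates its end (else its last-but-one), strip the new Z-slot,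
and encode the path reversed in front of the enumeration.

THIS FILE (part 4).  `mem_psiWith_iff_of_ne` (slots other than `z, pen, pen2` are untouched by the dumps), the origin lemmas
`u_mem_of_pen_mem_psiWith`, `u_mem_of_pen2_mem_psiWith`, `mem_psiWith_of_u_mem`; `psiWith_injective` (same plan ⇒ `Ψ` injective on
configurations with that non-A set); and `psiWith_ne_of_suffix`: if the path of `P'` is `Q ++ P.path` with `Q ≠ []` then
`Ψ_P S ≠ Ψ_{P'} S'` for BAD `S, S'` — the contradiction is carried by the arc between the two path starts `x = P'.u`, `y = P.u`
(an `F_x`-witness of slot `y`, resp. an `F_y`-witness of slot `x`, is traced through `Ψ` to a killer sitting in a non-A slot; the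
residual case `|P.path| = 2`, `P'` of type II is exactly where the rule "start → last-but-one" is used).
-/

namespace Summit.CriticalPhenomena.PercolationContinuityZ3.Theorems.SunflowerPartition

namespace TypeModel

open Finset Literature.Combinatorics.Digraph

variable {K : ℕ} {ι : Type*} {Λ : Type*}

namespace Model

variable {M : Model K ι Λ} {S : ι → Finset (Fin K)}

/-! ### Decoding: what `Ψ` remembers -/

section Decoding

variable {N : Finset (Fin K)} (P : M.Plan N)

/-- Slots other than `z`, `pen` (and `pen2` in type II) are untouched by the dumps: membership in `Ψ S x` is membership of
the `ρ`-preimage in `S x`. [this work] -/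
theorem mem_psiWith_iff_of_ne {x : ι} {k : Fin K} (hkz : k ≠ P.z) (hkp : k ≠ P.pen)
    (hkq : P.v = none ∨ k ≠ P.pen2) : k ∈ M.psiWith P S x ↔ P.rho.symm k ∈ S x := by
  classical
  rw [← mem_map_rho P]
  unfold psiWith; simp only
  split_ifs with hu hzt hpt
  · rw [Finset.mem_insert, Finset.mem_erase]; simp [hkz, hkp]
  · have hkq' : k ≠ P.pen2 := by
      rcases hkq with h | h
      · simp [h] at hpt
      · exact h
    rw [Finset.mem_insert, Finset.mem_erase]; simp [hkz, hkq']
  · rfl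
  · rfl

/-- Where an element of slot `u` ends up: in `pen` (if it is an `F_z`-element), in `pen2` (type II, an `F_pen`- but not
`F_z`-element), or in `z` (otherwise). [this work] -/
theorem mem_psiWith_of_u_mem {x : ι} (hux : P.u ∈ S x) :
    (P.z ∈ M.τ x → P.pen ∈ M.psiWith P S x) ∧
    (P.z ∉ M.τ x → P.v.isSome → P.pen ∈ M.τ x → P.pen2 ∈ M.psiWith P S x) ∧
    (P.z ∉ M.τ x → ¬ (P.v.isSome ∧ P.pen ∈ M.τ x) → P.z ∈ M.psiWith P S x) := by
  classical
  unfold psiWith; simp only [hux, if_true]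
  refine ⟨fun hzt => by simp [hzt], fun hzt hs hpt => by simp [hzt, hs, hpt], fun hzt hnp => ?_⟩
  rw [if_neg hzt, if_neg hnp]
  exact (z_mem_map_rho_iff P).2 hux

variable (hN : N = M.nonA S)
include hN

/-- ORIGIN (ii): an `F_z`-element found in slot `pen` of `Ψ S` came from slot `u` of `S`. [this work] -/
theorem u_mem_of_pen_mem_psiWith {x : ι} (hpx : P.pen ∈ M.psiWith P S x) (hzt : P.z ∈ M.τ x) : P.u ∈ S x := by
  classical
  by_contra hu
  have hz : ¬ M.IsA S P.z := (M.mem_nonA S).1 (hN ▸ P.z_mem)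
  unfold psiWith at hpx; simp only [hu, if_false] at hpx
  rw [pen_mem_map_rho_iff] at hpx
  exact hz ⟨x, hpx, hzt⟩

/-- ORIGIN (iii), type II: an `F_pen`-element found in slot `pen2` of `Ψ S` came from slot `u` of `S`. [this work] -/
theorem u_mem_of_pen2_mem_psiWith {x : ι} {v : Fin K} (hv : P.v = some v) (hqx : P.pen2 ∈ M.psiWith P S x)
    (hpt : P.pen ∈ M.τ x) : P.u ∈ S x := by
  classical
  by_contra hu
  have hp : ¬ M.IsA S P.pen := (M.mem_nonA S).1 (hN ▸ P.pen_mem)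
  unfold psiWith at hqx; simp only [hu, if_false] at hqx
  rw [pen2_mem_map_rho_iff P hv] at hqx
  exact hp ⟨x, hqx, hpt⟩

/-- **Decoding lemma**: for a fixed plan, `Ψ` is injective on configurations whose non-A set is `N`. [this work] -/
theorem psiWith_injective {S' : ι → Finset (Fin K)} (hN' : N = M.nonA S') (h : M.psiWith P S = M.psiWith P S') :
    S = S' := by
  classical
  -- no killers in the slots z, pen of either configuration
  have hzS : ∀ {x}, P.z ∈ S x → P.z ∉ M.τ x := fun hx ht => (M.mem_nonA S).1 (hN ▸ P.z_mem) ⟨_, hx, ht⟩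
  have hzS' : ∀ {x}, P.z ∈ S' x → P.z ∉ M.τ x := fun hx ht => (M.mem_nonA S').1 (hN' ▸ P.z_mem) ⟨_, hx, ht⟩
  have hpS : ∀ {x}, P.pen ∈ S x → P.pen ∉ M.τ x := fun hx ht => (M.mem_nonA S).1 (hN ▸ P.pen_mem) ⟨_, hx, ht⟩
  have hpS' : ∀ {x}, P.pen ∈ S' x → P.pen ∉ M.τ x := fun hx ht => (M.mem_nonA S').1 (hN' ▸ P.pen_mem) ⟨_, hx, ht⟩
  funext x
  have hx := congrFun h x
  have hρinj : Function.Injective (fun T : Finset (Fin K) => T.map P.rho.toEmbedding) :=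
    Finset.map_injective _
  -- Step 1: `u ∈ S x ↔ u ∈ S' x`
  have key_u : P.u ∈ S x ↔ P.u ∈ S' x := by
    by_cases hzt : P.z ∈ M.τ x
    · constructor
      · intro hu
        have h1 := (mem_psiWith_of_u_mem P hu).1 hzt
        rw [hx] at h1
        exact u_mem_of_pen_mem_psiWith P hN' h1 hzt
      · intro hu
        have h1 := (mem_psiWith_of_u_mem P hu).1 hzt
        rw [← hx] at h1
        exact u_mem_of_pen_mem_psiWith P hN h1 hzt
    by_cases hpt : P.v.isSome ∧ P.pen ∈ M.τ x
    · obtain ⟨v, hv⟩ := Option.isSome_iff_exists.1 hpt.1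
      constructor
      · intro hu
        have h1 := (mem_psiWith_of_u_mem P hu).2.1 hzt hpt.1 hpt.2
        rw [hx] at h1
        exact u_mem_of_pen2_mem_psiWith P hN' hv h1 hpt.2
      · intro hu
        have h1 := (mem_psiWith_of_u_mem P hu).2.1 hzt hpt.1 hpt.2
        rw [← hx] at h1
        exact u_mem_of_pen2_mem_psiWith P hN hv h1 hpt.2
    · constructor
      · intro hu
        have h1 := (mem_psiWith_of_u_mem P hu).2.2 hzt hpt
        rw [hx] at h1
        exact (of_z_mem_psiWith P h1).1
      · intro hu
        have h1 := (mem_psiWith_of_u_mem P hu).2.2 hzt hpt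
        rw [← hx] at h1
        exact (of_z_mem_psiWith P h1).1
  -- Step 2: compare the two branches
  unfold psiWith at hx; simp only at hx
  by_cases hu : P.u ∈ S x
  · have hu' : P.u ∈ S' x := key_u.1 hu
    rw [if_pos hu, if_pos hu'] at hx
    have hzin : P.z ∈ (S x).map P.rho.toEmbedding := (z_mem_map_rho_iff P).2 hu
    have hzin' : P.z ∈ (S' x).map P.rho.toEmbedding := (z_mem_map_rho_iff P).2 hu'
    by_cases hzt : P.z ∈ M.τ x
    · rw [if_pos hzt, if_pos hzt] at hx
      have hp1 : P.pen ∉ ((S x).map P.rho.toEmbedding).erase P.z := by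
        rw [Finset.mem_erase, pen_mem_map_rho_iff]; rintro ⟨-, h'⟩; exact hzS h' hzt
      have hp2 : P.pen ∉ ((S' x).map P.rho.toEmbedding).erase P.z := by
        rw [Finset.mem_erase, pen_mem_map_rho_iff]; rintro ⟨-, h'⟩; exact hzS' h' hzt
      have h3 : ((S x).map P.rho.toEmbedding).erase P.z = ((S' x).map P.rho.toEmbedding).erase P.z := by
        have := congrArg (fun T => T.erase P.pen) hx
        simpa [Finset.erase_insert hp1, Finset.erase_insert hp2] using this
      have h4 : (S x).map P.rho.toEmbedding = (S' x).map P.rho.toEmbedding := by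
        rw [← Finset.insert_erase hzin, ← Finset.insert_erase hzin', h3]
      exact hρinj h4
    · rw [if_neg hzt, if_neg hzt] at hx
      by_cases hpt : P.v.isSome ∧ P.pen ∈ M.τ x
      · rw [if_pos hpt, if_pos hpt] at hx
        obtain ⟨v, hv⟩ := Option.isSome_iff_exists.1 hpt.1
        have hp1 : P.pen2 ∉ ((S x).map P.rho.toEmbedding).erase P.z := by
          rw [Finset.mem_erase, pen2_mem_map_rho_iff P hv]; rintro ⟨-, h'⟩; exact hpS h' hpt.2
        have hp2 : P.pen2 ∉ ((S' x).map P.rho.toEmbedding).erase P.z := by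
          rw [Finset.mem_erase, pen2_mem_map_rho_iff P hv]; rintro ⟨-, h'⟩; exact hpS' h' hpt.2
        have h3 : ((S x).map P.rho.toEmbedding).erase P.z = ((S' x).map P.rho.toEmbedding).erase P.z := by
          have := congrArg (fun T => T.erase P.pen2) hx
          simpa [Finset.erase_insert hp1, Finset.erase_insert hp2] using this
        have h4 : (S x).map P.rho.toEmbedding = (S' x).map P.rho.toEmbedding := by
          rw [← Finset.insert_erase hzin, ← Finset.insert_erase hzin', h3]
        exact hρinj h4
      · rw [if_neg hpt, if_neg hpt] at hx
        exact hρinj hx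
  · have hu' : P.u ∉ S' x := fun h' => hu (key_u.2 h')
    rw [if_neg hu, if_neg hu'] at hx
    exact hρinj hx

end Decoding

/-! ### No collisions across different path lengths (memo §4.5) -/

section Cross

variable {S' : ι → Finset (Fin K)} {N N' : Finset (Fin K)} (P : M.Plan N) (P' : M.Plan N') (Q : List (Fin K))

/-- Last-two cancellation for lists. -/
private theorem append_pair_inj {L L' : List (Fin K)} {a b c d : Fin K} (h : L ++ [a, b] = L' ++ [c, d]) :
    L = L' ∧ a = c ∧ b = d := by
  obtain ⟨h1, h2⟩ := List.append_inj' h rfl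
  simp only [List.cons.injEq, and_true] at h2
  exact ⟨h1, h2.1, h2.2⟩

/-- Last-three cancellation for lists. -/
private theorem append_triple_inj {L L' : List (Fin K)} {a b c a' b' c' : Fin K}
    (h : L ++ [a, b, c] = L' ++ [a', b', c']) : L = L' ∧ a = a' ∧ b = b' ∧ c = c' := by
  obtain ⟨h1, h2⟩ := List.append_inj' h rfl
  simp only [List.cons.injEq, and_true] at h2
  exact ⟨h1, h2.1, h2.2.1, h2.2.2⟩

variable (hpath : P'.path = Q ++ P.path)
include hpath

/-- A left extension of the path has the same end `z`. [this work] -/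
theorem z_eq_of_suffix : P'.z = P.z := by
  obtain ⟨L, hL⟩ := P.path_eq_pen_z
  obtain ⟨L', hL'⟩ := P'.path_eq_pen_z
  have h : (Q ++ L) ++ [P.pen, P.z] = L' ++ [P'.pen, P'.z] := by
    rw [List.append_assoc, ← hL, ← hpath, hL']
  exact (append_pair_inj h).2.2.symm

/-- A left extension of the path has the same last-but-one slot. [this work] -/
theorem pen_eq_of_suffix : P'.pen = P.pen := by
  obtain ⟨L, hL⟩ := P.path_eq_pen_z
  obtain ⟨L', hL'⟩ := P'.path_eq_pen_z
  have h : (Q ++ L) ++ [P.pen, P.z] = L' ++ [P'.pen, P'.z] := by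
    rw [List.append_assoc, ← hL, ← hpath, hL']
  exact (append_pair_inj h).2.1.symm

/-- If both plans are of type II, their `pen2` agree. -/
theorem pen2_eq_of_suffix {v v' : Fin K} (hv : P.v = some v) (hv' : P'.v = some v') : P'.pen2 = P.pen2 := by
  obtain ⟨L, hL⟩ := P.path_eq_pen2_pen_z hv
  obtain ⟨L', hL'⟩ := P'.path_eq_pen2_pen_z hv'
  have h : (Q ++ L) ++ [P.pen2, P.pen, P.z] = L' ++ [P'.pen2, P'.pen, P'.z] := by
    rw [List.append_assoc, ← hL, ← hpath, hL']
  exact (append_triple_inj h).2.1.symm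

/-- If `P'` is of type II and the common suffix `P.path` has at least three entries, then `P'.pen2` immediately precedes
`pen` in `P.path`, so `ρ_P pen = P'.pen2`. -/
theorem rho_pen_eq_pen2'_of_suffix {v' : Fin K} (hv' : P'.v = some v') (h3 : 3 ≤ P.path.length) :
    P.rho P.pen = P'.pen2 := by
  obtain ⟨L', hL'⟩ := P'.path_eq_pen2_pen_z hv'
  -- write P.path = A ++ [a, b, c]
  obtain ⟨L, hL⟩ := P.path_eq_pen_z
  obtain ⟨A, a, hA⟩ : ∃ A a, L = A ++ [a] := by
    rcases List.eq_nil_or_concat L with h0 | ⟨A, a, ha⟩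
    · rw [hL, h0] at h3; simp at h3
    · exact ⟨A, a, by simpa using ha⟩
  have hP : P.path = A ++ [a, P.pen, P.z] := by rw [hL, hA]; simp
  have h : (Q ++ A) ++ [a, P.pen, P.z] = L' ++ [P'.pen2, P'.pen, P'.z] := by
    rw [List.append_assoc, ← hP, ← hpath, hL']
  have ha : a = P'.pen2 := (append_triple_inj h).2.1
  rw [← ha]
  unfold Plan.rho; rw [hP]
  have hnd : (A ++ a :: P.pen :: [P.z]).Nodup := by
    have := P.nodup_path; rwa [hP] at this
  exact formPerm_reverse_apply_next hnd

omit hpath in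
/-- If `P.path` has only two entries then `pen = u`. -/
theorem pen_eq_u_of_length_two (h2 : P.path.length = 2) : P.pen = P.u := by
  obtain ⟨L, hL⟩ := P.path_eq_pen_z
  have hL0 : L = [] := by
    rw [hL] at h2
    simpa using h2
  rw [hL0] at hL
  have hu : P.path.head? = some P.u := by unfold Plan.path; simp
  rw [hL] at hu; simp at hu; exact hu

/-- `P'.u ∉ N` when `Q ≠ []` (it is the head of `Q`), and `P.u ∈ N'`, and they differ. -/
theorem u'_facts (hQ : Q ≠ []) : P'.u ∉ N ∧ P.u ∈ N' ∧ P'.u ≠ P.u := by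
  have hnd : (Q ++ P.path).Nodup := by rw [← hpath]; exact P'.nodup_path
  have hhead : (Q ++ P.path).head? = some P'.u := by rw [← hpath]; unfold Plan.path; simp
  obtain ⟨q, Q', rfl⟩ : ∃ q Q', Q = q :: Q' := by
    cases Q with
    | nil => exact absurd rfl hQ
    | cons q Q' => exact ⟨q, Q', rfl⟩
  simp only [List.cons_append, List.head?_cons, Option.some.injEq] at hhead
  subst hhead
  have hdis : P'.u ∉ P.path := by
    intro hm
    have hnd' := hnd
    rw [List.cons_append, List.nodup_cons] at hnd'
    exact hnd'.1 (List.mem_append_right _ hm)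
  refine ⟨fun h => hdis (P.mem_path_iff.2 h), ?_, fun h => hdis (h ▸ by unfold Plan.path; simp)⟩
  rw [← P'.mem_path_iff, hpath]; exact List.mem_append_right _ (by unfold Plan.path; simp)

omit hpath in
/-- Length of a plan's path is at least `2`, and at least `3` in type II. -/
theorem length_path_ge : 2 ≤ P.path.length ∧ (P.v.isSome → 3 ≤ P.path.length) := by
  unfold Plan.path; cases P.v <;> simp

variable (hN : N = M.nonA S) (hN' : N' = M.nonA S') (hS : M.Bad S) (hS' : M.Bad S')
include hN hN' hS hS'

/-- **No cross-length collisions**: a BAD `S` with plan `P` and a BAD `S'` with plan `P'` whose path properly extends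
`P`'s path on the left cannot have the same image under `Ψ`. [this work] -/
theorem psiWith_ne_of_suffix (hQ : Q ≠ []) : M.psiWith P S ≠ M.psiWith P' S' := by
  classical
  intro hg
  obtain ⟨hxN, hyN', hxy⟩ := u'_facts P P' Q hpath hQ
  set x := P'.u with hx
  set y := P.u with hy
  have hxN' : x ∈ N' := P'.u_mem
  have hyN : y ∈ N := P.u_mem
  -- no killers in non-A slots
  have nk : ∀ {k} {e : ι}, k ∈ N → k ∈ S e → k ∉ M.τ e :=
    fun hk hke hkt => (M.mem_nonA S).1 (hN ▸ hk) ⟨_, hke, hkt⟩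
  have nk' : ∀ {k} {e : ι}, k ∈ N' → k ∈ S' e → k ∉ M.τ e :=
    fun hk hke hkt => (M.mem_nonA S').1 (hN' ▸ hk) ⟨_, hke, hkt⟩
  have hz : P'.z = P.z := z_eq_of_suffix P P' Q hpath
  have hp : P'.pen = P.pen := pen_eq_of_suffix P P' Q hpath
  -- Claim A: `O x y` is impossible
  have claimA : ¬ M.O x y := by
    intro hOxy
    -- slot y of S holds an F_x witness e
    obtain ⟨e, hye, hxe⟩ := (hS.2.1 y (hN ▸ hyN)).2.2 x hOxy
    have goal : x ∈ S' e → False := fun h => nk' hxN' h hxe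
    have hw := mem_psiWith_of_u_mem (S := S) P hye
    by_cases hzt : P.z ∈ M.τ e
    · -- e ends in pen; on the S'-side that forces x ∈ S' e
      have h1 : P.pen ∈ M.psiWith P' S' e := by rw [← hg]; exact hw.1 hzt
      rw [← hp] at h1
      exact goal (u_mem_of_pen_mem_psiWith (S := S') P' hN' h1 (hz ▸ hzt))
    by_cases hpt : P.v.isSome ∧ P.pen ∈ M.τ e
    · -- P type II, e ends in pen2
      obtain ⟨v, hv⟩ := Option.isSome_iff_exists.1 hpt.1
      have h1 : P.pen2 ∈ M.psiWith P' S' e := by rw [← hg]; exact hw.2.1 hzt hpt.1 hpt.2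
      rcases hv' : P'.v with _ | v'
      · -- P' type I: pen2 ∈ Ψ' e means ρ'⁻¹ pen2 = pen ∈ S' e, a killer in a non-A slot
        have hne1 : P.pen2 ≠ P'.z := by rw [hz]; exact P.pen2_ne_z_of_typeII hv
        have hne2 : P.pen2 ≠ P'.pen := by
          rw [hp]; intro h
          obtain ⟨L, hL⟩ := P.path_eq_pen2_pen_z hv
          have := P.nodup_path; rw [hL] at this
          have := (List.nodup_append.1 this).2.1; simp [h] at this
        have h2 := (mem_psiWith_iff_of_ne (S := S') P' hne1 hne2 (Or.inl hv')).1 h1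
        -- ρ' pen = pen2 : pen2 precedes pen in P.path hence in P'.path
        have hρ' : P'.rho P.pen = P.pen2 := by
          obtain ⟨L, hL⟩ := P.path_eq_pen2_pen_z hv
          unfold Plan.rho; rw [hpath, hL, ← List.append_assoc]
          have hnd : ((Q ++ L) ++ P.pen2 :: P.pen :: [P.z]).Nodup := by
            have := P'.nodup_path; rwa [hpath, hL, ← List.append_assoc] at this
          exact formPerm_reverse_apply_next hnd
        rw [(Equiv.symm_apply_eq _).2 hρ'.symm] at h2
        exact nk' (hp ▸ P'.pen_mem) h2 hpt.2
      · -- P' type II: pen2' = pen2, origin (iii) on the S'-side gives x ∈ S' e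
        have hq : P'.pen2 = P.pen2 := pen2_eq_of_suffix P P' Q hpath hv hv'
        rw [← hq] at h1
        exact goal (u_mem_of_pen2_mem_psiWith (S := S') P' hN' hv' h1 (hp ▸ hpt.2))
    · -- e stays in z
      have h1 : P.z ∈ M.psiWith P' S' e := by rw [← hg]; exact hw.2.2 hzt hpt
      rw [← hz] at h1
      exact goal (of_z_mem_psiWith (S := S') P' h1).1
  -- the arc between x and y
  have harc : M.O x y ∨ M.O y x :=
    M.semicomplete_of_bad S' hS' x (hN' ▸ hxN') y (hN' ▸ hyN') hxy
  rcases harc with hOxy | hOyx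
  · exact claimA hOxy
  -- Claim B: `O y x`; slot x of S' holds an F_y witness e
  obtain ⟨e, hxe, hye⟩ := (hS'.2.1 x (hN' ▸ hxN')).2.2 y hOyx
  have goal : y ∈ S e → False := fun h => nk hyN h hye
  have hw := mem_psiWith_of_u_mem (S := S') P' hxe
  by_cases hzt : P'.z ∈ M.τ e
  · have h1 : P'.pen ∈ M.psiWith P S e := by rw [hg]; exact hw.1 hzt
    rw [hp] at h1
    exact goal (u_mem_of_pen_mem_psiWith (S := S) P hN h1 (hz ▸ hzt))
  by_cases hpt : P'.v.isSome ∧ P'.pen ∈ M.τ e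
  · obtain ⟨v', hv'⟩ := Option.isSome_iff_exists.1 hpt.1
    have h1 : P'.pen2 ∈ M.psiWith P S e := by rw [hg]; exact hw.2.1 hzt hpt.1 hpt.2
    rcases hv : P.v with _ | v
    · -- P type I
      by_cases h3 : 3 ≤ P.path.length
      · -- pen2' precedes pen in P.path: ρ_P pen = pen2', so pen ∈ S e — a killer (pen ∈ τ e) in a non-A slot
        have hρ : P.rho P.pen = P'.pen2 := rho_pen_eq_pen2'_of_suffix P P' Q hpath hv' h3
        have hne1 : P'.pen2 ≠ P.z := hz ▸ P'.pen2_ne_z_of_typeII hv'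
        have hne2 : P'.pen2 ≠ P.pen := by
          rw [← hp]; intro h
          obtain ⟨L, hL⟩ := P'.path_eq_pen2_pen_z hv'
          have := P'.nodup_path; rw [hL] at this
          have := (List.nodup_append.1 this).2.1; simp [h] at this
        have h2 := (mem_psiWith_iff_of_ne (S := S) P hne1 hne2 (Or.inl hv)).1 h1
        rw [(Equiv.symm_apply_eq _).2 hρ.symm] at h2
        exact nk P.pen_mem h2 (hp ▸ hpt.2)
      · -- |P.path| = 2: pen = y, and P'.dom gives O x pen' = O x y: Claim A
        have h2 : P.path.length = 2 := by
          have := (length_path_ge P).1; omega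
        have hpu : P.pen = P.u := pen_eq_u_of_length_two P h2
        have hdom : M.O x P'.pen := by
          have := P'.dom; unfold Plan.pen; rw [hv']; exact this
        rw [hp, hpu] at hdom
        exact claimA hdom
    · -- P type II: pen2 = pen2', origin (iii) on the S-side
      have hq : P'.pen2 = P.pen2 := pen2_eq_of_suffix P P' Q hpath hv hv'
      rw [hq] at h1
      exact goal (u_mem_of_pen2_mem_psiWith (S := S) P hN hv h1 (hp ▸ hpt.2))
  · have h1 : P'.z ∈ M.psiWith P S e := by rw [hg]; exact hw.2.2 hzt hpt
    rw [hz] at h1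
    exact goal (of_z_mem_psiWith (S := S) P h1).1

end Cross

end Model

end TypeModel

end Summit.CriticalPhenomena.PercolationContinuityZ3.Theorems.SunflowerPartition
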